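import Mathlib
import HarnessLib
import Literature.Computability.AlgebraicComplexity.PatternExpressions
import Summits.ValiantsHypothesis.ValiantsHypothesis.Theorems.MonotoneRestorationOrbitCompressionQPFormulaSubstitution
import Summits.ValiantsHypothesis.ValiantsHypothesis.Theorems.MonotoneRestorationOrbitRestorationQPCloseAlgebra
import Literature.Computability.AlgebraicComplexity.QPBoundedClosure

/-!
# Route MonotoneRestoration — aside `OrbitCompressionQP` (stmt-ValiantsHypothesis-18332), line
# `expression_compression`: the conclusion class of `stub_narrowExpressionCompression` is closed under
# `VQP` POST-COMPOSITION

`NQP(f) :≡ ∃ c, ∀ n ≥ 1, ∃ k l (e : PatternExpr ℂ k l), n^{k+l} ≤ 2^{(log₂ n + c)^c} ∧ |e| ≤ 2^{(log₂ n + c)^c} ∧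
e.close n = f n` (the conclusion of the open stub, spelled out).  `Theorems/…NarrowClosure*.lean` closed this
class under scalars, binary sums and products and quasi-polynomially many summands.  With the substitution
engine of `Theorems/…FormulaSubstitution.lean` (`VQP_e = VQP` transported to pattern expressions) the class
is closed under EVERY quasi-polynomially computable polynomial map with p-boundedly many arguments:

* `close_eq_nsmul_of_value_const`, `exists_close_eq_of_value_const_kl` — closing / normalising an
  expression whose value does not depend on the assignment (`k`, `l` labels: factor `n^k · n^l`);
* `exists_const_twin`, `exists_const_twin_one` — from a CLOSED presentation `e` of `p = e.close n` to an
  expression with prescribed label counts whose VALUE is `p` at every assignment (sum out all labels, then pad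
  with idle labels; at the level `n = 1` collapse all labels first, so that the length stays `|e| + 2`);
* ★ `narrowQP_postcompose` — for a `VQP` family `Q_n ∈ ℂ[y_1, …, y_{m(n)}]` and families `f_{n,j}`
  (`j < m n`) that are narrow of quasi-polynomial length UNIFORMLY in `j`, the family
  `n ↦ Q_n(f_{n,0}, …, f_{n,m(n)-1})` is narrow of quasi-polynomial length.

Helper file (`--supports stmt-ValiantsHypothesis-18332`); def-free; nothing here is a named fact; no registered
stub is closed; VP ≠ VNP is not moved.
-/

noncomputable section

open MvPolynomial

-- `Summit.ValiantsHypothesis.ValiantsHypothesis.…` is the tree's single-conjunct layout (Sub = Summit).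
set_option linter.dupNamespace false

namespace Summit.ValiantsHypothesis.ValiantsHypothesis.Theorems

namespace FormulaSubstitution

open Literature.Computability.AlgebraicComplexity OrbitRestorationQPHomPolyClose

/-! ### Single level: constant-valued expressions -/

section SingleLevel

variable {F : Type} [CommSemiring F] {k l : ℕ}

/-- Closing an expression whose value does not depend on the assignment: `close n e = (n^k · n^l) • v`.
[folklore] -/
theorem close_eq_nsmul_of_value_const (n : ℕ) (e : PatternExpr F k l) (v : MvPolynomial (Fin n × Fin n) F)
    (hv : ∀ (ρ : Fin k → Fin n) (γ : Fin l → Fin n), e.value n ρ γ = v) :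
    e.close n = (n ^ k * n ^ l) • v := by
  unfold PatternExpr.close
  simp only [hv, Finset.sum_const, Finset.card_univ, Fintype.card_fun, Fintype.card_fin, smul_smul]

/-- **From a closed presentation to a constant-valued one** (`n` arbitrary, label counts `k ≤ K`, `l ≤ L`):
sum out every label of `e` and pad with idle labels; the value is `e.close n` at every assignment and the
length is `|e| + l + k`. [folklore] -/
theorem exists_const_twin (n : ℕ) (e : PatternExpr F k l) {K L : ℕ} (hK : k ≤ K) (hL : l ≤ L) :
    ∃ ψ : PatternExpr F K L, ψ.length = e.length + l + k ∧
      ∀ (ρ : Fin K → Fin n) (γ : Fin L → Fin n), ψ.value n ρ γ = e.close n := by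
  obtain ⟨ψ, hlen, hv⟩ := NarrowClosure.exists_value_eq_pad hK hL n
    ((List.finRange k).foldr PatternExpr.sumRow ((List.finRange l).foldr PatternExpr.sumCol e))
  exact ⟨ψ, by rw [hlen, NarrowClosure.length_sumAll], fun ρ γ => by
    rw [hv, value_sumAll_eq_close]⟩

/-- **The same at the level `n = 1`, for ANY label counts** (`1 ≤ K`, `1 ≤ L`): collapse all labels of `e` to
one a side first (`NarrowClosure.exists_value_eq_collapse`), then sum out and pad; length `|e| + 2`.
[folklore] -/
theorem exists_const_twin_one (e : PatternExpr F k l) {K L : ℕ} (hK : 1 ≤ K) (hL : 1 ≤ L) :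
    ∃ ψ : PatternExpr F K L, ψ.length = e.length + 2 ∧
      ∀ (ρ : Fin K → Fin 1) (γ : Fin L → Fin 1), ψ.value 1 ρ γ = e.close 1 := by
  obtain ⟨e₀, hlen₀, hv₀⟩ := NarrowClosure.exists_value_eq_collapse e
  obtain ⟨ψ, hlen, hv⟩ := exists_const_twin 1 e₀ hK hL
  refine ⟨ψ, by rw [hlen, hlen₀], fun ρ γ => ?_⟩
  rw [hv, PatternExpr.close, PatternExpr.close, Fintype.sum_unique, Fintype.sum_unique, Fintype.sum_unique,
    Fintype.sum_unique]
  exact hv₀ _ _ _ _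

/-- Normalising a constant-valued expression at `n ≥ 1` (over `ℂ`): length `|e| + 2`, `close = v`. [folklore] -/
theorem exists_close_eq_of_value_const_kl {n : ℕ} (hn : 1 ≤ n) (e : PatternExpr ℂ k l)
    (v : MvPolynomial (Fin n × Fin n) ℂ)
    (hv : ∀ (ρ : Fin k → Fin n) (γ : Fin l → Fin n), e.value n ρ γ = v) :
    ∃ e' : PatternExpr ℂ k l, e'.length = e.length + 2 ∧ e'.close n = v := by
  refine ⟨PatternExpr.mul (PatternExpr.const (((n ^ k * n ^ l : ℕ) : ℂ))⁻¹) e,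
    by simp [PatternExpr.length]; ring, ?_⟩
  have hN : ((n ^ k * n ^ l : ℕ) : ℂ) ≠ 0 := by
    have h0 : n ≠ 0 := by omega
    exact_mod_cast mul_ne_zero (pow_ne_zero k h0) (pow_ne_zero l h0)
  rw [ShortClose.close_const_mul, close_eq_nsmul_of_value_const n e v hv, ← Nat.cast_smul_eq_nsmul ℂ,
    smul_smul, inv_mul_cancel₀ hN, one_smul]

end SingleLevel

/-! ### Family level: post-composition with `VQP` families -/

section Family

/-- ★ **`NQP` is closed under `VQP` post-composition.**  Let `Q_n ∈ ℂ[y_1, …, y_{m(n)}]` be a `VQP` family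
(`m` is p-bounded as part of `IsPFamily`) and let `f_{n,j}` (`j < m n`) be closed polynomials of pattern
expressions of quasi-polynomial length with polylogarithmically many labels, with ONE constant for all `n ≥ 1`
and all `j < m n`.  Then `n ↦ Q_n(f_{n,0}, …, f_{n,m(n)-1})` is narrow of quasi-polynomial length.
Mechanism: constant-valued twins with a common label count `(log₂ n + a)^a` a side (`exists_const_twin`, at
`n = 1` `exists_const_twin_one`), the `VQP` substitution principle
`FormulaSubstitution.exists_narrow_subst_of_isVQPFamily` (BCS (21.33)), normalisation.
[cite: BurgisserClausenShokrollahi1997, Thm. (21.33)] -/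
theorem narrowQP_postcompose {m : ℕ → ℕ} (Q : (n : ℕ) → MvPolynomial (Fin (m n)) ℂ) (hQ : IsVQPFamily Q)
    (f : (n : ℕ) → ℕ → MvPolynomial (Fin n × Fin n) ℂ)
    (hf : ∃ c : ℕ, ∀ n : ℕ, 1 ≤ n → ∀ j : ℕ, j < m n → ∃ (k l : ℕ) (e : PatternExpr ℂ k l),
      n ^ (k + l) ≤ 2 ^ ((Nat.log 2 n + c) ^ c) ∧ e.length ≤ 2 ^ ((Nat.log 2 n + c) ^ c) ∧
      e.close n = f n j) :
    ∃ c : ℕ, ∀ n : ℕ, 1 ≤ n → ∃ (k l : ℕ) (e : PatternExpr ℂ k l),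
      n ^ (k + l) ≤ 2 ^ ((Nat.log 2 n + c) ^ c) ∧ e.length ≤ 2 ^ ((Nat.log 2 n + c) ^ c) ∧
      e.close n = aeval (fun j : Fin (m n) => f n j.val) (Q n) := by
  classical
  obtain ⟨a, ha⟩ := hf
  -- common label count `M n = (log₂ n + a)^a` a side
  set M : ℕ → ℕ := fun n => (Nat.log 2 n + a) ^ a with hM
  have hM1 : ∀ n, 1 ≤ M n := fun n => IsQPBounded.one_le_qexp _ _
  -- constant-valued substituends
  have hsub : ∀ n : ℕ, ∃ ψs : Fin (m n) → PatternExpr ℂ (M n) (M n), 1 ≤ n → ∀ j : Fin (m n),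
      (ψs j).length ≤ 2 ^ ((Nat.log 2 n + a) ^ a) + 2 * M n ∧
      ∀ (ρ γ : Fin (M n) → Fin n), (ψs j).value n ρ γ = f n j.val := by
    intro n
    by_cases hn : 1 ≤ n
    swap
    · exact ⟨fun _ => PatternExpr.const 0, fun h => absurd h hn⟩
    have hex : ∀ j : Fin (m n), ∃ ψ : PatternExpr ℂ (M n) (M n),
        ψ.length ≤ 2 ^ ((Nat.log 2 n + a) ^ a) + 2 * M n ∧
        ∀ (ρ γ : Fin (M n) → Fin n), ψ.value n ρ γ = f n j.val := by
      intro j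
      obtain ⟨k, l, e, hkl, hlen, hclose⟩ := ha n hn j.val j.isLt
      rcases Nat.lt_or_ge n 2 with h1 | h2
      · -- the level `n = 1`
        have hn1 : n = 1 := by omega
        subst hn1
        obtain ⟨ψ, hψl, hψv⟩ := exists_const_twin_one e (hM1 1) (hM1 1)
        exact ⟨ψ, by rw [hψl]; have := hM1 1; omega, fun ρ γ => by rw [hψv, hclose]⟩
      · have hlab : k + l ≤ M n := NarrowClosure.labels_le_of_pow_le h2 hkl
        obtain ⟨ψ, hψl, hψv⟩ := exists_const_twin n e (K := M n) (L := M n) (by omega) (by omega)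
        exact ⟨ψ, by rw [hψl]; omega, fun ρ γ => by rw [hψv, hclose]⟩
    choose ψs hψs using hex
    exact ⟨ψs, fun _ j => hψs j⟩
  choose θ hθ using hsub
  -- the substituends have quasi-polynomial length
  have hθqp : ∃ c : ℕ, ∀ n : ℕ, 1 ≤ n → ∀ j : Fin (m n),
      (θ n j).length ≤ 2 ^ ((Nat.log 2 n + c) ^ c) := by
    obtain ⟨c, hc⟩ := NarrowClosure.qp_combine a 0
    refine ⟨c, fun n hn j => ?_⟩
    have h1 := (hθ n hn j).1
    have h2 : M n ≤ 2 ^ ((Nat.log 2 n + a) ^ a) := CompressionFloors.polylog_le_qp n a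
    have h3 := hc (Nat.log 2 n) (2 ^ ((Nat.log 2 n + a) ^ a)) 1 le_rfl (by simp)
    calc (θ n j).length ≤ 3 * 2 ^ ((Nat.log 2 n + a) ^ a) := by omega
      _ ≤ (2 ^ ((Nat.log 2 n + a) ^ a) + 2) * (1 + 2) := by omega
      _ ≤ 2 ^ ((Nat.log 2 n + c) ^ c) := h3
  obtain ⟨c₁, hc₁⟩ := exists_narrow_subst_of_isVQPFamily Q hQ (k := M) (l := M) θ hθqp
  obtain ⟨c₂, hc₂⟩ := CompressionFloors.labels_qp a
  obtain ⟨c₃, hc₃⟩ := NarrowClosure.qp_combine c₁ 0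
  refine ⟨max c₂ c₃, fun n hn => ?_⟩
  obtain ⟨e, hlen, hv⟩ := hc₁ n hn
  have hval : ∀ (ρ γ : Fin (M n) → Fin n),
      e.value n ρ γ = aeval (fun j : Fin (m n) => f n j.val) (Q n) := by
    intro ρ γ
    have hfun : (fun i : Fin (m n) => (θ n i).value n ρ γ) = fun j : Fin (m n) => f n j.val :=
      funext fun j => (hθ n hn j).2 ρ γ
    rw [hv, hfun]
  obtain ⟨e', hlen', hclose'⟩ := exists_close_eq_of_value_const_kl hn e _ hval
  refine ⟨M n, M n, e', ?_, ?_, hclose'⟩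
  · exact (hc₂ n (M n) le_rfl).trans
      (Nat.pow_le_pow_right (by norm_num) (CompressionFloors.polylog_mono (le_max_left _ _)))
  · have h := hc₃ (Nat.log 2 n) e.length 0 hlen (by simp)
    calc e'.length = e.length + 2 := hlen'
      _ ≤ (e.length + 2) * (0 + 2) := by omega
      _ ≤ 2 ^ ((Nat.log 2 n + c₃) ^ c₃) := h
      _ ≤ 2 ^ ((Nat.log 2 n + max c₂ c₃) ^ max c₂ c₃) :=
          Nat.pow_le_pow_right (by norm_num) (CompressionFloors.polylog_mono (le_max_right _ _))

/-- The `VP` case. [cite: BurgisserClausenShokrollahi1997, §21.5] -/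
theorem narrowQP_postcompose_VP {m : ℕ → ℕ} (Q : (n : ℕ) → MvPolynomial (Fin (m n)) ℂ) (hQ : IsVPFamily Q)
    (f : (n : ℕ) → ℕ → MvPolynomial (Fin n × Fin n) ℂ)
    (hf : ∃ c : ℕ, ∀ n : ℕ, 1 ≤ n → ∀ j : ℕ, j < m n → ∃ (k l : ℕ) (e : PatternExpr ℂ k l),
      n ^ (k + l) ≤ 2 ^ ((Nat.log 2 n + c) ^ c) ∧ e.length ≤ 2 ^ ((Nat.log 2 n + c) ^ c) ∧
      e.close n = f n j) :
    ∃ c : ℕ, ∀ n : ℕ, 1 ≤ n → ∃ (k l : ℕ) (e : PatternExpr ℂ k l),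
      n ^ (k + l) ≤ 2 ^ ((Nat.log 2 n + c) ^ c) ∧ e.length ≤ 2 ^ ((Nat.log 2 n + c) ^ c) ∧
      e.close n = aeval (fun j : Fin (m n) => f n j.val) (Q n) :=
  narrowQP_postcompose Q hQ.isVQPFamily f hf

end Family

end FormulaSubstitution

end Summit.ValiantsHypothesis.ValiantsHypothesis.Theorems

end
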